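import Summits.QuantumFields.YangMills.Theorems.BalabanUVNodesN27AtEpsSmallFieldsGen13CoPH
import Summits.QuantumFields.YangMills.Theorems.BalabanUVNodesN18AtRateRecord13CoPHRunTowersGenBelow

/-!
# BalabanUVNodes ∕ N27 = binder B5 AT THE RECORD — XLIIᶜᵒᵖᴴ AT THE ε-SMALL FIELDS ON THE GENERATED HISTORY WITH N18 IN THE (GEN)-BELOW-THE-RUN-LENGTH CURRENCY: N18 AND N22 BOTH
# READ OFF THE GENERATOR (trigger (t2) of this seat: a producer face in a NEW currency at the v1.7 `CoPH` reading): the N18 slot of XLIIᶜᵒᵖᴴ `…N27AtEpsSmallFieldsGen13CoPH` (§1: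
# dag-n18-d module 18's envelope face with UNCONDITIONAL `AnalyticH` ∕ `Bound238` of the generated run towers; §2: closed form at θ) is REPLACED by dag-n18-d's (GEN)-below-the-run-length rows
# `YMDAG.N18.W1Reading.s_N18_rRec₁₃CoPH_readingAdm_runTowers_toClusterTower_of_stepGen_lt_pin` ∕ `…_rRec₁₃CoPHOn_readingAdm_runTowers_toClusterTower_of_stepGen_lt_pin`
# (`…N18AtRateRecord13CoPHRunTowersGenBelow`; θ-free `n18At_u3OfRecord₁₃_readingAdm_runTowers_toClusterTower_of_stepGen_lt` underneath) at the pin `readingOfRecord₁₃CoPH_u3`, their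
# hypothesis VERBATIM at the plaquette-small tables ∕ transport of record: THE END's data over the carriers of the admissible level pairing (functionals of the generated RUN towers) and
# dag-n18-c's per-GENERATOR schema (GEN) — «older terms of steps `j ≤ m` analytic with sup letter `E` on the table ⟹ the generated term `(G F θ k m).H t old · Z` analytic on the table with
# envelope `A·e^{−R_d d_{m+1}(Z)}`» — for the steps BELOW THE RUN LENGTHS (`m < k` for run A, `m < k + 1` for run B), coupling domains `Dc F θ k ⊇ ]0, γ′]`, renewals `e·9·64·K₀²·A ≤ E`,
# letters dominating.  So at this junction N18 (via (GEN)) and N22 (via dag-n22-e 8b″'s W1 schemas `AnalyticInLast` ∕ `PropagatesAnalyticity` + sup-letter schema on `recTerm (G F θ k)`)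
# are BOTH statements about the generator `G` on the plaquette-small tables — the currency a producer of Bałaban's (2.14)–(2.26) generator would discharge
# (cell `pub-ymgap`, HUMAN RULING D-0062 Track A, R134 seat `pub-ymgap-dag-n27-c` (s2) gen 9; K3⁷ `SpineGivenEndpointR13SepCoPH` = stmt-QuantumFields-20544, `--kind proof --supports 20544 --as helper`;
# COUNT-NEUTRAL; `N`-generic, regime-generic, NO Theses import — the item-facing face is ONE application of leaf A §4 `spineGivenEndpointR13SepCoPH_of_spine_rec13CCoPHOn` at
# `Rg := Node00.unityNondeg₁₃H 2`, `N = 2` at the call site)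

THE READING (as XLIIᶜᵒᵖᴴ).  `readingOfRecord₁₃CoPH (fun F θ ↦ ReadingData.ofRecordAdm F θ.τ9.M N (runTowers fun k ↦ toClusterTower (G F θ k)) (fun k j _ ↦ (ι·, 0) '' {V | PlaqSmall (a F θ.toStage12Params k) V})
(gauge F θ) (hg F θ) (fun k ↦ transportRaw F k (avOfRecord F N (k+1) 0)) (admTransport_plaqSmall_sharp a ha hstep hguard F θ.toStage12Params) (li F θ)) ℓ₃ ne2 ne1`; side conditions `ha`, `hstep`,
`hguard` on the thresholds `a` (Stage-12-keyed, read at `θ.toStage12Params`).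

WHAT IS KERNEL-CHECKED ([bookkeeping]; 0 `def`, 0 `sorry`; each theorem ONE application of XLᶜᵒᵖᴴ `spine_rec13CCoPH(On)_at_readingOfRecord₁₃CoPH` with the producers' theorems in the slots):
* §1 `spine_rec13CCoPH_at_epsSmallFieldsGen₁₃CoPH_of_stepGen_lt` — CANONICAL HOME: XLIIᶜᵒᵖᴴ §1 with `h18` ⟸ the (GEN)-below-the-run-length row (canonical), N22 ⟸ that N18 by 8b″
  `s_N22_readingOfRecord₁₃CoPH_gen_of_s_N18_schemasBelow` (schemas + eleven numerals VERBATIM); N14 ∕ N15 at `h.params`, `InEndRegime ∧ LeafSlot` once per family, (D4), spine side as XLIIᶜᵒᵖᴴ.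
* §2 `spine_rec13CCoPHOn_at_epsSmallFieldsGen₁₃CoPH_of_stepGen_lt` — REGIME HOME, any `Rg`: XLIIᶜᵒᵖᴴ §2 with `h18` ⟸ the (GEN)-below-the-run-length row asked of the tuples IN THE REGIME
  and N22 ⟸ that N18 by 8b″'s regime edge `s_N22_readingOfRecord₁₃CoPHOn_gen_of_s_N18_schemasBelow` ⇒ `Spine (IsRecordOfRecord₁₃CCoPHOn Rg)`; at `Rg := Node00.unityNondeg₁₃H N` RR-2's CN class.

HONEST FRAMING.  COMPOSITE-node bookkeeping BY NAME: the generator `G`, the coupling domains `Dc`, the gauges, the letters are residual DATA (INHABITATION IS NOT CONTENT — a discharge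
names Bałaban's (2.14)–(2.26) generator); (GEN), THE END's data, W1's schemas, the numerals, NE1′, NE2, `InEndRegime ∧ LeafSlot`, (D4), NE7b, NE7c, the extraction clause and NE7's core edge are
DISPLAYED hypotheses with no producer at the ₁₃ reading today (0∕1); (GEN) is dag-n18-c's cell paraphrase, NOT Bałaban's sentence and NOT proved for his generator; whether Bałaban's generated
terms satisfy any schema on the ε-small tables is asserted NOWHERE here; nothing of Bałaban's asserted or instantiated; no `Provisos₁₃CoPH` inhabitant claimed (K0⁷ open); N18 ∕ N22 ∕ N27 NOT
discharged; K3⁷ NOT claimed; counts UNMOVED (typed 28∕28 · discharged 5∕27, A 5∕28); one finite four-torus programme at fixed `ε` — NOT ℝ⁴, NOT infinite volume, NOT OS, NOT a mass gap,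
NOT Clay.  General-`N` throughout.  No decl below carries a cite tag.
-/

noncomputable section

open Set Metric ComplexConjugate
open scoped Matrix.Norms.L2Operator

namespace Summit.QuantumFields.YangMills.Theorems.BalabanUVNodesN27SpineRecord

open Literature.MathematicalPhysics.QuantumFieldTheory.Balaban1983to89
open Literature.MathematicalPhysics.QuantumFieldTheory.Balaban1983to89.T4Continuum
open Literature.MathematicalPhysics.QuantumFieldTheory.Balaban1983to89.T4OutputRate (Carriers Functional NE5 DecayBound Window)
open Literature.MathematicalPhysics.QuantumFieldTheory.Balaban1983to89.T4InputCauchyRateData (StepModel)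
open Literature.MathematicalPhysics.QuantumFieldTheory.Balaban1983to89.B13Resummation (locE)
open Literature.MathematicalPhysics.QuantumFieldTheory.Balaban1983to89.TreeLengthTorus (TDom tsys torusTreeLen)
open Literature.MathematicalPhysics.QuantumFieldTheory.Balaban1983to89.TreeLengthTorusGeometry (TTouch)
open Literature.MathematicalPhysics.QuantumFieldTheory.Balaban1983to89.B12TreeDecay (K₀)
open Literature.MathematicalPhysics.QuantumFieldTheory.Balaban1983to89.ExpMeanLog (deltaSU)
open T4ContinuumYM4Torus (ForSmallCouplings)
open Summit.QuantumFields.BalabanUV.T4Continuum.Spine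
open Summit.QuantumFields.BalabanUV.T4Continuum.Spine.NE5
open Summit.QuantumFields.BalabanUV.T4Continuum.B13Carriers (transportRaw)
open YMDAG.UVSplit
open YMDAG.N18.HLayer
open YMDAG.N18.W1Reading (s_N18_rRec₁₃CoPH_readingAdm_runTowers_toClusterTower_of_stepGen_lt_pin s_N18_rRec₁₃CoPHOn_readingAdm_runTowers_toClusterTower_of_stepGen_lt_pin
  admTransport_plaqSmall_sharp)
open YMDAG.N22 (s_N22_readingOfRecord₁₃CoPH_gen_of_s_N18_schemasBelow s_N22_readingOfRecord₁₃CoPHOn_gen_of_s_N18_schemasBelow)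
open Node00 (Stage12Params Stage13HParams datumOfRecord₁₃CoPH IsRecordOfRecord₁₃CCoPH IsDatumOfRecord₁₃CCoPH NE3Letters₁₁ NE2Objects₁₁ ne3ConstLayerOfRecord₁₁ MatA ιSU prependCoupling avOfRecord)
open Node00.Sect2 (domCount domSys CPair ofBackgroundC cubeDom)
open Node00.W1
open Summit.QuantumFields.YangMills.BalabanUVNodes.N16Regime (InEndRegime)
open Summit.QuantumFields.YangMills.BalabanUVNodes.N16LeafSlot (LeafSlot)
open Summit.QuantumFields.YangMills.BalabanUVNodes.N16AtRRec13CoPH (s_N16_rRec₁₃CoPH_of_constLayer_leafSlot s_N16_rRec₁₃CoPHOn_ofRecord_of_leafSlot)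

variable {N : ℕ} [NeZero N] (cr : SpineReading₁₃CoPH N)
  (G : (F : T4Family) → (θ : Stage13HParams F N) → (k : ℕ) → GenTower (F.P k) (MatA N) θ.τ9.M)
  (Dc : (F : T4Family) → Stage13HParams F N → ℕ → Set ℂ)
  (a : (F : T4Family) → Stage12Params F N → ℕ → ℝ)
  (ha : ∀ (F : T4Family) (θ : Stage12Params F N) (k : ℕ), 0 < a F θ (k + 1))
  (hstep : ∀ (F : T4Family) (θ : Stage12Params F N) (k : ℕ),
    ((F.P (k + 1)).L : ℝ) ^ 2 * a F θ (k + 1) + 143 * (((((F.P (k + 1)).d + 4) * (F.P (k + 1)).L : ℕ) : ℝ) ^ 2 / 4 * a F θ (k + 1)) ^ 2 ≤ a F θ k)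
  (hguard : ∀ (F : T4Family) (θ : Stage12Params F N) (k : ℕ),
    ((((F.P (k + 1)).d + 4) * (F.P (k + 1)).L : ℕ) : ℝ) ^ 2 / 4 * a F θ (k + 1) ≤ deltaSU (Fin N) / 2)
  (gauge : (F : T4Family) → (θ : Stage13HParams F N) → (k : ℕ) → GaugeField (F.P k) 0 (Node00.SU N) → GaugeField (F.P k) 0 (Node00.SU N) → ℝ)
  (hg : ∀ (F : T4Family) (θ : Stage13HParams F N) (k : ℕ) (U U' : GaugeField (F.P k) 0 (Node00.SU N)), 0 ≤ gauge F θ k U U')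
  (li : (F : T4Family) → Stage13HParams F N → LetterInputs) (ℓ₃ : T4Family → NE3Letters₁₁)
  (ne2 : (F : T4Family) → Stage13HParams F N → (ℕ → ℝ) → List (ULoop F) → ℕ → NE2Objects₁₁)
  (ne1 : (F : T4Family) → Stage13HParams F N → (ℕ → ℝ) → List (ULoop F) → NE1pCarriers)

/-! ## §1 The canonical home at the ε-small fields on the generated history, N18 in the (GEN)-below-the-run-length currency -/

section Canonical

open Classical in
/-- **N27 = B5 AT THE STAGE-13 `CoPH` RECORD FROM THE SLOTS AT THE CANONICAL HOME OF THE ADMISSIBLE READING ON THE GENERATED HISTORY AT THE ε-SMALL FIELDS — N17 ∕ N22 ELIMINATED,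
N18 AND N22 BOTH FROM SCHEMAS FOR THE GENERATOR** (XLᶜᵒᵖᴴ `spine_rec13CCoPH_at_readingOfRecord₁₃CoPH` at the reading of the header; `h18` ⟸ dag-n18-d
`YMDAG.N18.W1Reading.s_N18_rRec₁₃CoPH_readingAdm_runTowers_toClusterTower_of_stepGen_lt_pin` at `hpin := readingOfRecord₁₃CoPH_u3 …`, its hypothesis VERBATIM at the plaquette-small
tables ∕ transport of record: per admissible Stage-13 tuple with provisos and run length `k` — (i) THE END's data over the carriers of the admissible level pairing (step models `Mb b`,
`locE` read-out action, L01–L03 ∕ L07 ∕ L08 (letter `E_B`) ∕ L09* on `]0, γ′]`, numerals), (ii) `SpRestr` of the tables and (GEN) for the generators `G F θ k m`, `m < k`, and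
`G F θ (k+1) m`, `m < k + 1`, at couplings `t ∈ Dc F θ k` with envelopes `A_A` ∕ `A_B`, renewals `e·9·64·K₀²·A ≤ E`, `]0, γ′] ⊆ Dc F θ k`, letters dominating; N22 ⟸ that N18 by
dag-n22-e 8b″ `s_N22_readingOfRecord₁₃CoPH_gen_of_s_N18_schemasBelow` — W1's per-step schemas for `G F θ k` on the plaquette-small table + the complex sup-letter schema on
`recTerm (G F θ k)` + eleven numerals VERBATIM).  NE1′ ∕ NE2 at `h.params`, `InEndRegime ∧ LeafSlot` once per family, (D4) displayed; spine side N20 ∕ N21 ∕ extraction at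
`SRec₁₃CoPH cr`, home-keyed N19′ edge.  Every hypothesis 0∕1 today. [bookkeeping] -/
theorem spine_rec13CCoPH_at_epsSmallFieldsGen₁₃CoPH_of_stepGen_lt
    (h14 : ∀ (F : T4Family) (D : Datum F N) (h : IsDatumOfRecord₁₃CCoPH F N D) (g₀ : ℕ → ℝ) (os : List (ULoop F)), N14At (ne1 F h.params g₀ os))
    (h15 : ∀ (F : T4Family) (D : Datum F N) (h : IsDatumOfRecord₁₃CCoPH F N D) (g₀ : ℕ → ℝ) (os : List (ULoop F)) (k : ℕ),
      N15At (ne2OfRecord₁₁ (ne2 F h.params g₀ os k)))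
    (h16 : ∀ (F : T4Family), (∃ D : Datum F N, IsDatumOfRecord₁₃CCoPH F N D) →
      InEndRegime (ne3OfRecord₁₁ F (ne3ConstLayerOfRecord₁₁ F N (ℓ₃ F))) ∧ LeafSlot (ne3OfRecord₁₁ F (ne3ConstLayerOfRecord₁₁ F N (ℓ₃ F))))
    -- N18 ⟸ THE END's data + (GEN) BELOW THE RUN LENGTHS for the generator on the plaquette-small tables (dag-n18-d `…_runTowers_toClusterTower_of_stepGen_lt_pin`, verbatim)
    (h18 : ∀ (F : T4Family) (θ : Stage13HParams F N), θ.Provisos₁₃CoPH F N → θ.Admissible F N → ∀ k : ℕ,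
      ∃ (Op : Type) (_ : NormedAddCommGroup Op) (_ : NormedSpace ℂ Op) (Hist : Type) (_ : NormedAddCommGroup Hist) (_ : NormedSpace ℂ Hist)
        (Mb : ℝ → StepModel (LevelPairing.ofRecordAdm F θ.τ9.M N k (fun (k j : ℕ) (_ : (domSys (F.P k) θ.τ9.M j).Dom) =>
            ofBackgroundC (ιSU N) '' {V : GaugeField (F.P k) 0 (Node00.SU N) | PlaqSmall (a F θ.toStage12Params k) V})
          (gauge F θ k) (hg F θ k) (transportRaw F k (avOfRecord F N (k + 1) 0)) (admTransport_plaqSmall_sharp a ha hstep hguard F θ.toStage12Params k)).carriers Op Hist)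
        (act : ℝ → (j : ℕ) → Op × Hist → TDom 4 (domCount (F.P k) θ.τ9.M j) → ℂ) (γ' C3 ε₁ Rd κ A_A A_B E_A E_B E₁ δ δ' θr θ' cH ω ρ₀ B : ℝ)
        (k₀ : ℕ),
        (∀ b : ℝ, 0 < b → b ≤ γ' → ∀ (X : Node00.W1.Dom (F.P k) θ.τ9.M) (z : Op × Hist),
          (Mb b).Out X.1 z.1 z.2 X =
            locE (TTouch (d := 4) (N := domCount (F.P k) θ.τ9.M X.1)) (fun Z : (tsys 4 (domCount (F.P k) θ.τ9.M X.1)).Dom => Z.1)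
              (act b X.1 z) X.2.1) ∧
        0 ≤ C3 ∧ 0 ≤ ε₁ ∧ 0 ≤ κ ∧ κ + 2 * (64 * Real.log 162) + 2 ≤ Rd ∧
        C3 * ε₁ * Real.exp (5 * κ + 1) * K₀ 64 8 * 9 * 64 ≤ 1 ∧
        (∀ b : ℝ, 0 < b → b ≤ γ' → ∀ j, ∀ g ∈ Window γ',
          ∀ (U : (LevelPairing.ofRecordAdm F θ.τ9.M N k (fun (k j : ℕ) (_ : (domSys (F.P k) θ.τ9.M j).Dom) =>
            ofBackgroundC (ιSU N) '' {V : GaugeField (F.P k) 0 (Node00.SU N) | PlaqSmall (a F θ.toStage12Params k) V})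
          (gauge F θ k) (hg F θ k) (transportRaw F k (avOfRecord F N (k + 1) 0)) (admTransport_plaqSmall_sharp a ha hstep hguard F θ.toStage12Params k)).BgB) (q : Op × Hist),
          q ∈ (Mb b).Base j g U →
          ∃ V : Set (Op × Hist), IsOpen V ∧ (Mb b).box j q ⊆ V ∧
            (∀ Z : TDom 4 (domCount (F.P k) θ.τ9.M j), DifferentiableOn ℂ (fun z : Op × Hist => act b j z Z) V) ∧
            (∀ z ∈ V, ∀ Z : TDom 4 (domCount (F.P k) θ.τ9.M j), ‖act b j z Z‖ ≤ C3 * ε₁ * Real.exp (-(Rd * torusTreeLen Z.1)))) ∧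
        (∀ b : ℝ, 0 < b → b ≤ γ' → L01 (Mb b)
          ((LevelPairing.ofRecordAdm F θ.τ9.M N k (fun (k j : ℕ) (_ : (domSys (F.P k) θ.τ9.M j).Dom) =>
            ofBackgroundC (ιSU N) '' {V : GaugeField (F.P k) 0 (Node00.SU N) | PlaqSmall (a F θ.toStage12Params k) V})
          (gauge F θ k) (hg F θ k) (transportRaw F k (avOfRecord F N (k + 1) 0)) (admTransport_plaqSmall_sharp a ha hstep hguard F θ.toStage12Params k)).EA
            (runTowers (fun k => toClusterTower (G F θ k)) k)) (Window γ')) ∧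
        (∀ b : ℝ, 0 < b → b ≤ γ' → L02 (Mb b)
          ((LevelPairing.ofRecordAdm F θ.τ9.M N k (fun (k j : ℕ) (_ : (domSys (F.P k) θ.τ9.M j).Dom) =>
            ofBackgroundC (ιSU N) '' {V : GaugeField (F.P k) 0 (Node00.SU N) | PlaqSmall (a F θ.toStage12Params k) V})
          (gauge F θ k) (hg F θ k) (transportRaw F k (avOfRecord F N (k + 1) 0)) (admTransport_plaqSmall_sharp a ha hstep hguard F θ.toStage12Params k)).EB
            (runTowers (fun k => toClusterTower (G F θ k)) (k + 1)) b) (Window γ')) ∧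
        (∀ b : ℝ, 0 < b → b ≤ γ' → L03 (Mb b)
          ((LevelPairing.ofRecordAdm F θ.τ9.M N k (fun (k j : ℕ) (_ : (domSys (F.P k) θ.τ9.M j).Dom) =>
            ofBackgroundC (ιSU N) '' {V : GaugeField (F.P k) 0 (Node00.SU N) | PlaqSmall (a F θ.toStage12Params k) V})
          (gauge F θ k) (hg F θ k) (transportRaw F k (avOfRecord F N (k + 1) 0)) (admTransport_plaqSmall_sharp a ha hstep hguard F θ.toStage12Params k)).EB
            (runTowers (fun k => toClusterTower (G F θ k)) (k + 1)) b) (Window γ')) ∧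
        (∀ b : ℝ, 0 < b → b ≤ γ' → L07 (Mb b) (Window γ') δ θr) ∧
        (∀ b : ℝ, 0 < b → b ≤ γ' → L08 (Mb b) (Window γ') κ (Real.exp 1 * 9 * 64 * K₀ 64 8 ^ 2 * A_B) δ' θr) ∧
        (∀ b : ℝ, 0 < b → b ≤ γ' → L09aff (Mb b) (Window γ')) ∧ (∀ b : ℝ, 0 < b → b ≤ γ' → L09blind (Mb b) (Window γ')) ∧
        (∀ b : ℝ, 0 < b → b ≤ γ' → L09hom (Mb b) (Window γ')) ∧ (∀ b : ℝ, 0 < b → b ≤ γ' → L09unit (Mb b) (Window γ') κ E₁ cH ω) ∧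
        0 < E₁ ∧ 0 ≤ δ + δ' ∧ 0 ≤ θr ∧ θr ≤ θ' ∧ θ' ≤ 1 ∧ 0 ≤ cH ∧ 0 < ω ∧ ρ₀ < 1 ∧
        (δ + δ') * θr ^ k₀ +
            cH * (Real.exp 1 * 9 * 64 * K₀ 64 8 ^ 2 * A_A + Real.exp 1 * 9 * 64 * K₀ 64 8 ^ 2 * A_B) / (1 - ω) ≤ ρ₀ ∧
        0 ≤ B ∧ (∀ k < k₀, Real.exp 1 * 9 * 64 * K₀ 64 8 ^ 2 * A_A + Real.exp 1 * 9 * 64 * K₀ 64 8 ^ 2 * A_B ≤ B * θr ^ k) ∧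
        Real.exp 1 * 9 * 64 * K₀ 64 8 ^ 2 * C3 * cH * ε₁ < (θ' - ω) * (1 - ρ₀) ∧
        (∀ m, SpRestr (fun _ : (domSys (F.P k) θ.τ9.M (m + 1)).Dom => ofBackgroundC (ιSU N) '' {V : GaugeField (F.P k) 0 (Node00.SU N) | PlaqSmall (a F θ.toStage12Params k) V})) ∧
        (∀ m < k, ∀ t ∈ Dc F θ k, ∀ old : OlderTerms (F.P k) (MatA N) θ.τ9.M m,
          (∀ (j : Fin (m + 1)) (Y : (domSys (F.P k) θ.τ9.M j).Dom), ∀ ψ ∈ ofBackgroundC (ιSU N) '' {V : GaugeField (F.P k) 0 (Node00.SU N) | PlaqSmall (a F θ.toStage12Params k) V},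
              ‖old j Y ψ‖ ≤ E_A * Real.exp (-(κ * (domSys (F.P k) θ.τ9.M j).dj Y))) →
          (∀ (j : Fin (m + 1)) (Y : (domSys (F.P k) θ.τ9.M j).Dom), AnalyticOnNhd ℂ (old j Y) (ofBackgroundC (ιSU N) '' {V : GaugeField (F.P k) 0 (Node00.SU N) | PlaqSmall (a F θ.toStage12Params k) V})) →
          (∀ Z : (domSys (F.P k) θ.τ9.M (m + 1)).Dom, AnalyticOnNhd ℂ (fun φ => (G F θ k m).H t old φ Z) (ofBackgroundC (ιSU N) '' {V : GaugeField (F.P k) 0 (Node00.SU N) | PlaqSmall (a F θ.toStage12Params k) V})) ∧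
          (∀ (Z : (domSys (F.P k) θ.τ9.M (m + 1)).Dom), ∀ φ ∈ ofBackgroundC (ιSU N) '' {V : GaugeField (F.P k) 0 (Node00.SU N) | PlaqSmall (a F θ.toStage12Params k) V},
              ‖(G F θ k m).H t old φ Z‖ ≤ A_A * Real.exp (-(Rd * (domSys (F.P k) θ.τ9.M (m + 1)).dj Z)))) ∧
        0 ≤ A_A ∧ A_A * Real.exp (5 * κ + 1) * K₀ 64 8 * 9 * 64 < 1 ∧ Real.exp 1 * 9 * 64 * K₀ 64 8 ^ 2 * A_A ≤ E_A ∧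
        (∀ m, SpRestr (fun _ : (domSys (F.P (k + 1)) θ.τ9.M (m + 1)).Dom => ofBackgroundC (ιSU N) '' {V : GaugeField (F.P (k + 1)) 0 (Node00.SU N) | PlaqSmall (a F θ.toStage12Params (k + 1)) V})) ∧
        (∀ m < k + 1, ∀ t ∈ Dc F θ k, ∀ old : OlderTerms (F.P (k + 1)) (MatA N) θ.τ9.M m,
          (∀ (j : Fin (m + 1)) (Y : (domSys (F.P (k + 1)) θ.τ9.M j).Dom), ∀ ψ ∈ ofBackgroundC (ιSU N) '' {V : GaugeField (F.P (k + 1)) 0 (Node00.SU N) | PlaqSmall (a F θ.toStage12Params (k + 1)) V},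
              ‖old j Y ψ‖ ≤ E_B * Real.exp (-(κ * (domSys (F.P (k + 1)) θ.τ9.M j).dj Y))) →
          (∀ (j : Fin (m + 1)) (Y : (domSys (F.P (k + 1)) θ.τ9.M j).Dom), AnalyticOnNhd ℂ (old j Y) (ofBackgroundC (ιSU N) '' {V : GaugeField (F.P (k + 1)) 0 (Node00.SU N) | PlaqSmall (a F θ.toStage12Params (k + 1)) V})) →
          (∀ Z : (domSys (F.P (k + 1)) θ.τ9.M (m + 1)).Dom, AnalyticOnNhd ℂ (fun φ => (G F θ (k + 1) m).H t old φ Z) (ofBackgroundC (ιSU N) '' {V : GaugeField (F.P (k + 1)) 0 (Node00.SU N) | PlaqSmall (a F θ.toStage12Params (k + 1)) V})) ∧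
          (∀ (Z : (domSys (F.P (k + 1)) θ.τ9.M (m + 1)).Dom), ∀ φ ∈ ofBackgroundC (ιSU N) '' {V : GaugeField (F.P (k + 1)) 0 (Node00.SU N) | PlaqSmall (a F θ.toStage12Params (k + 1)) V},
              ‖(G F θ (k + 1) m).H t old φ Z‖ ≤ A_B * Real.exp (-(Rd * (domSys (F.P (k + 1)) θ.τ9.M (m + 1)).dj Z)))) ∧
        0 ≤ A_B ∧ A_B * Real.exp (5 * κ + 1) * K₀ 64 8 * 9 * 64 < 1 ∧ Real.exp 1 * 9 * 64 * K₀ 64 8 ^ 2 * A_B ≤ E_B ∧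
        (∀ s ∈ Ioc (0 : ℝ) γ', ((s : ℝ) : ℂ) ∈ Dc F θ k) ∧
        θ.γ ≤ γ' ∧ (li F θ).κ ≤ κ ∧ θ' ≤ (li F θ).θ₅ ∧
        (Real.exp 1 * 9 * 64 * K₀ 64 8 ^ 2 * (C3 * ε₁) / (1 - ρ₀) * (δ + δ') + B) * (θ' - ω) /
            (θ' - (ω + Real.exp 1 * 9 * 64 * K₀ 64 8 ^ 2 * (C3 * ε₁) / (1 - ρ₀) * cH)) ≤ (li F θ).C₅)
    -- N22 ⟸ N18 ON THE GENERATED TOWERS (dag-n22-e module 8b″): W1's per-step SCHEMAS for the generator `G F θ k` on the plaquette-small table + ONE inequality schema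
    -- (the complex sup letter for the generated terms at the readings of the ε-small fields) + eleven numerals — verbatim; NO junk pin, NO coherence, NO readings clause
    (hsch : ∀ (F : T4Family) (θ : Stage13HParams F N), θ.Provisos₁₃CoPH F N → θ.Admissible F N → ∀ (k : ℕ),
      ∃ (Dk : Set ℂ) (Adm : (m : ℕ) → Set (OlderTerms (F.P k) (MatA N) θ.τ9.M m)),
        IsOpen Dk ∧ (∀ z ∈ Dk, conj z ∈ Dk) ∧ (∀ t ∈ Ioc (0 : ℝ) θ.γ, closedBall (t : ℂ) (li F θ).r ⊆ Dk) ∧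
        (∀ g : ℕ → ℂ, (∀ n, g n ∈ Dk) → ∀ m < k, olderOf (recTerm (G F θ k) g) m ∈ Adm m) ∧
        (∀ m < k, (G F θ k m).AnalyticInLast Dk (Adm m) (fun _ : (domSys (F.P k) θ.τ9.M (m + 1)).Dom => ofBackgroundC (ιSU N) '' {V : GaugeField (F.P k) 0 (Node00.SU N) | PlaqSmall (a F θ.toStage12Params k) V})) ∧
        (∀ m < k, (G F θ k m).PropagatesAnalyticity Dk (Adm m) (fun (j : Fin (m + 1)) (_ : (domSys (F.P k) θ.τ9.M j).Dom) => ofBackgroundC (ιSU N) '' {V : GaugeField (F.P k) 0 (Node00.SU N) | PlaqSmall (a F θ.toStage12Params k) V}) (fun _ : (domSys (F.P k) θ.τ9.M (m + 1)).Dom => ofBackgroundC (ιSU N) '' {V : GaugeField (F.P k) 0 (Node00.SU N) | PlaqSmall (a F θ.toStage12Params k) V})) ∧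
        (∀ g ∈ Window θ.γ, ∀ (i j : ℕ), i < j → j ≤ k → ∀ (X : (domSys (F.P k) θ.τ9.M j).Dom), ∀ φ ∈ ofBackgroundC (ιSU N) '' {V : GaugeField (F.P k) 0 (Node00.SU N) | PlaqSmall (a F θ.toStage12Params k) V}, ∀ z ∈ Dk,
          ‖recTerm (G F θ k) (Function.update (fun n => ((g n : ℝ) : ℂ)) i z) j X φ‖ ≤
            (li F θ).A * (li F θ).μ ^ (j - 1 - i) * Real.exp (-((li F θ).κ * (domSys (F.P k) θ.τ9.M j).dj X))))
    (hnum : ∀ (F : T4Family) (θ : Stage13HParams F N), θ.Provisos₁₃CoPH F N → θ.Admissible F N →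
      0 < (li F θ).C₀ ∧ 0 < (li F θ).θ₅ ∧ (li F θ).θ₅ < 1 ∧ 0 ≤ (li F θ).C₅ ∧ 2 * (li F θ).C₅ / (1 - (li F θ).θ₅) ≤ (li F θ).C₀ ∧ 0 < (li F θ).A ∧
        (li F θ).θ₅ ≤ (li F θ).μ ∧ (li F θ).C₀ ≤ 2 * (li F θ).A ∧ 0 < (li F θ).r ∧ 0 < (li F θ).s ∧ (li F θ).s < 1)
    (hD4 : ∀ (F : T4Family) (D : Datum F N) (h : IsDatumOfRecord₁₃CCoPH F N D) (k : ℕ), ReadOutAt D (u3OfRecord₁₃ h.params.toStage13Params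
      ((ReadingData.ofRecordAdm F h.params.τ9.M N (runTowers fun k => toClusterTower (G F h.params k))
          (fun (k j : ℕ) (_ : (domSys (F.P k) h.params.τ9.M j).Dom) => ofBackgroundC (ιSU N) '' {V : GaugeField (F.P k) 0 (Node00.SU N) | PlaqSmall (a F h.params.toStage12Params k) V})
          (gauge F h.params) (hg F h.params) (fun k => transportRaw F k (avOfRecord F N (k + 1) 0)) (admTransport_plaqSmall_sharp a ha hstep hguard F h.params.toStage12Params) (li F h.params)).u3Objects h.params.γ) k))
    (hx' : S_N27x (fun F D w => IsRecordOfRecord₁₃CCoPH F N D w) (SRec₁₃CoPH cr)) (h20 : S_N20 (SRec₁₃CoPH cr)) (h21 : S_N21 (SRec₁₃CoPH cr))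
    (h19 : ∀ (F : T4Family) (θ : Stage13HParams F N) (hP : θ.Provisos₁₃CoPH F N), θ.Admissible F N → ∀ (g₀ : ℕ → ℝ) (os : List (ULoop F))
      (h : IsDatumOfRecord₁₃CCoPH F N (datumOfRecord₁₃CoPH F N θ hP)) (k : ℕ),
      RatesAt (datumOfRecord₁₃CoPH F N θ hP) (rateCarriersOfRecord₁₃CoPH (readingOfRecord₁₃CoPH
        (fun F θ => ReadingData.ofRecordAdm F θ.τ9.M N (runTowers fun k => toClusterTower (G F θ k))
          (fun (k j : ℕ) (_ : (domSys (F.P k) θ.τ9.M j).Dom) => ofBackgroundC (ιSU N) '' {V : GaugeField (F.P k) 0 (Node00.SU N) | PlaqSmall (a F θ.toStage12Params k) V})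
          (gauge F θ) (hg F θ) (fun k => transportRaw F k (avOfRecord F N (k + 1) 0)) (admTransport_plaqSmall_sharp a ha hstep hguard F θ.toStage12Params) (li F θ)) ℓ₃ ne2 ne1)
          F h.params h.provisos g₀ os k) → letI := (cr F θ hP g₀ os).dec
        ∃ δ : ℕ → ℝ, NE7.Core (cr F θ hP g₀ os).l₀ (cr F θ hP g₀ os).vol (cr F θ hP g₀ os).T (cr F θ hP g₀ os).Bad
          (fun K t τ => (cr F θ hP g₀ os).A K t τ - (cr F θ hP g₀ os).shA K t τ) (fun K t τ => (cr F θ hP g₀ os).B K t τ - (cr F θ hP g₀ os).shB K t τ) δ ∧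
          Summable δ) :
    Spine (N := N) fun F D w => IsRecordOfRecord₁₃CCoPH F N D w :=
  have h18' := s_N18_rRec₁₃CoPH_readingAdm_runTowers_toClusterTower_of_stepGen_lt_pin _ G Dc
    (fun F θ (k j : ℕ) (_ : (domSys (F.P k) θ.τ9.M j).Dom) => ofBackgroundC (ιSU N) '' {V : GaugeField (F.P k) 0 (Node00.SU N) | PlaqSmall (a F θ.toStage12Params k) V})
    gauge hg (fun F _ k => transportRaw F k (avOfRecord F N (k + 1) 0)) (fun F θ => admTransport_plaqSmall_sharp a ha hstep hguard F θ.toStage12Params) li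
    (readingOfRecord₁₃CoPH_u3 _ ℓ₃ ne2 ne1) h18
  spine_rec13CCoPH_at_readingOfRecord₁₃CoPH cr _ ℓ₃ ne2 ne1 ((s_N14_readingOfRecord₁₃CoPH_iff _ ℓ₃ ne2 ne1).mpr h14) ((s_N15_readingOfRecord₁₃CoPH_iff _ ℓ₃ ne2 ne1).mpr h15)
    (s_N16_rRec₁₃CoPH_of_constLayer_leafSlot (readingOfRecord₁₃CoPH _ ℓ₃ ne2 ne1) (fun F => ne3ConstLayerOfRecord₁₁ F N (ℓ₃ F)) (fun _ _ _ _ _ _ => rfl) h16) h18'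
    (s_N22_readingOfRecord₁₃CoPH_gen_of_s_N18_schemasBelow G
      (fun F θ (k j : ℕ) (_ : (domSys (F.P k) θ.τ9.M j).Dom) => ofBackgroundC (ιSU N) '' {V : GaugeField (F.P k) 0 (Node00.SU N) | PlaqSmall (a F θ.toStage12Params k) V})
      gauge hg (fun F _ k => transportRaw F k (avOfRecord F N (k + 1) 0)) (fun F θ => admTransport_plaqSmall_sharp a ha hstep hguard F θ.toStage12Params) li ne1 ℓ₃ ne2 h18' hsch hnum)
    ((s_D4_readingOfRecord₁₃CoPH_iff _ ℓ₃ ne2 ne1).mpr hD4) hx' h20 h21 h19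

end Canonical

/-! ## §2 The regime-restricted home at the ε-small fields on the generated history, any regime `Rg`, N18 in the (GEN)-below-the-run-length currency -/

section Regime

variable (Rg : (F : T4Family) → Stage13HParams F N → Prop)

open Classical in
/-- **N27 = B5 AT THE REGIME RECORD CLASS `IsRecordOfRecord₁₃CCoPHOn F N Rg` FROM THE SLOTS AT THE REGIME HOME OF THE ADMISSIBLE READING ON THE GENERATED HISTORY AT THE ε-SMALL
FIELDS, ANY `Rg` — N17 ∕ N22 ELIMINATED, N18 AND N22 BOTH FROM SCHEMAS FOR THE GENERATOR, ASKED ONLY OF THE TUPLES IN THE REGIME** (XLᶜᵒᵖᴴ `spine_rec13CCoPHOn_at_readingOfRecord₁₃CoPH`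
at the reading of the header; `h18` ⟸ dag-n18-d `YMDAG.N18.W1Reading.s_N18_rRec₁₃CoPHOn_readingAdm_runTowers_toClusterTower_of_stepGen_lt_pin` at `hpin := readingOfRecord₁₃CoPH_u3 …`
— THE END's data + (GEN) below the run lengths on the plaquette-small tables, VERBATIM, for the admissible tuples with provisos IN `Rg`; N22 ⟸ that N18 by dag-n22-e 8b″'s regime edge
`s_N22_readingOfRecord₁₃CoPHOn_gen_of_s_N18_schemasBelow` (schemas + numerals VERBATIM, asked in the regime)).  NE1′ ∕ NE2 at θ for tuples in the regime; NE3 once per guarded family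
(dag-n16-e `s_N16_rRec₁₃CoPHOn_ofRecord_of_leafSlot`); (D4) at θ; spine side N20 ∕ N21 at `SRec₁₃CoPHOn cr Rg`, the guarded keyed extraction clause, the same-tuple N19′ edge (as
XXXIXᶜᵒᵖᴴ).  At `Rg := Node00.unityNondeg₁₃H 2`, `N = 2` THE ITEM is leaf A §4 `spineGivenEndpointR13SepCoPH_of_spine_rec13CCoPHOn` of this.  Every hypothesis 0∕1 today. [bookkeeping] -/
theorem spine_rec13CCoPHOn_at_epsSmallFieldsGen₁₃CoPH_of_stepGen_lt
    (h14 : ∀ (F : T4Family) (θ : Stage13HParams F N), θ.Provisos₁₃CoPH F N → Rg F θ → θ.Admissible F N → ∀ (g₀ : ℕ → ℝ) (os : List (ULoop F)),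
      N14At (ne1 F θ g₀ os))
    (h15 : ∀ (F : T4Family) (θ : Stage13HParams F N), θ.Provisos₁₃CoPH F N → Rg F θ → θ.Admissible F N → ∀ (g₀ : ℕ → ℝ) (os : List (ULoop F)) (k : ℕ),
      N15At (ne2OfRecord₁₁ (ne2 F θ g₀ os k)))
    (h16 : ∀ (F : T4Family), (∃ θ : Stage13HParams F N, θ.Provisos₁₃CoPH F N ∧ Rg F θ ∧ θ.Admissible F N) →
      InEndRegime (ne3OfRecord₁₁ F (ne3ConstLayerOfRecord₁₁ F N (ℓ₃ F))) ∧ LeafSlot (ne3OfRecord₁₁ F (ne3ConstLayerOfRecord₁₁ F N (ℓ₃ F))))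
    -- N18 ⟸ THE END's data + (GEN) BELOW THE RUN LENGTHS, asked of the tuples IN THE REGIME (dag-n18-d `…On_readingAdm_runTowers_toClusterTower_of_stepGen_lt_pin`, verbatim)
    (h18 : ∀ (F : T4Family) (θ : Stage13HParams F N), θ.Provisos₁₃CoPH F N → Rg F θ → θ.Admissible F N → ∀ k : ℕ,
      ∃ (Op : Type) (_ : NormedAddCommGroup Op) (_ : NormedSpace ℂ Op) (Hist : Type) (_ : NormedAddCommGroup Hist) (_ : NormedSpace ℂ Hist)
        (Mb : ℝ → StepModel (LevelPairing.ofRecordAdm F θ.τ9.M N k (fun (k j : ℕ) (_ : (domSys (F.P k) θ.τ9.M j).Dom) =>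
            ofBackgroundC (ιSU N) '' {V : GaugeField (F.P k) 0 (Node00.SU N) | PlaqSmall (a F θ.toStage12Params k) V})
          (gauge F θ k) (hg F θ k) (transportRaw F k (avOfRecord F N (k + 1) 0)) (admTransport_plaqSmall_sharp a ha hstep hguard F θ.toStage12Params k)).carriers Op Hist)
        (act : ℝ → (j : ℕ) → Op × Hist → TDom 4 (domCount (F.P k) θ.τ9.M j) → ℂ) (γ' C3 ε₁ Rd κ A_A A_B E_A E_B E₁ δ δ' θr θ' cH ω ρ₀ B : ℝ)
        (k₀ : ℕ),
        (∀ b : ℝ, 0 < b → b ≤ γ' → ∀ (X : Node00.W1.Dom (F.P k) θ.τ9.M) (z : Op × Hist),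
          (Mb b).Out X.1 z.1 z.2 X =
            locE (TTouch (d := 4) (N := domCount (F.P k) θ.τ9.M X.1)) (fun Z : (tsys 4 (domCount (F.P k) θ.τ9.M X.1)).Dom => Z.1)
              (act b X.1 z) X.2.1) ∧
        0 ≤ C3 ∧ 0 ≤ ε₁ ∧ 0 ≤ κ ∧ κ + 2 * (64 * Real.log 162) + 2 ≤ Rd ∧
        C3 * ε₁ * Real.exp (5 * κ + 1) * K₀ 64 8 * 9 * 64 ≤ 1 ∧
        (∀ b : ℝ, 0 < b → b ≤ γ' → ∀ j, ∀ g ∈ Window γ',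
          ∀ (U : (LevelPairing.ofRecordAdm F θ.τ9.M N k (fun (k j : ℕ) (_ : (domSys (F.P k) θ.τ9.M j).Dom) =>
            ofBackgroundC (ιSU N) '' {V : GaugeField (F.P k) 0 (Node00.SU N) | PlaqSmall (a F θ.toStage12Params k) V})
          (gauge F θ k) (hg F θ k) (transportRaw F k (avOfRecord F N (k + 1) 0)) (admTransport_plaqSmall_sharp a ha hstep hguard F θ.toStage12Params k)).BgB) (q : Op × Hist),
          q ∈ (Mb b).Base j g U →
          ∃ V : Set (Op × Hist), IsOpen V ∧ (Mb b).box j q ⊆ V ∧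
            (∀ Z : TDom 4 (domCount (F.P k) θ.τ9.M j), DifferentiableOn ℂ (fun z : Op × Hist => act b j z Z) V) ∧
            (∀ z ∈ V, ∀ Z : TDom 4 (domCount (F.P k) θ.τ9.M j), ‖act b j z Z‖ ≤ C3 * ε₁ * Real.exp (-(Rd * torusTreeLen Z.1)))) ∧
        (∀ b : ℝ, 0 < b → b ≤ γ' → L01 (Mb b)
          ((LevelPairing.ofRecordAdm F θ.τ9.M N k (fun (k j : ℕ) (_ : (domSys (F.P k) θ.τ9.M j).Dom) =>
            ofBackgroundC (ιSU N) '' {V : GaugeField (F.P k) 0 (Node00.SU N) | PlaqSmall (a F θ.toStage12Params k) V})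
          (gauge F θ k) (hg F θ k) (transportRaw F k (avOfRecord F N (k + 1) 0)) (admTransport_plaqSmall_sharp a ha hstep hguard F θ.toStage12Params k)).EA
            (runTowers (fun k => toClusterTower (G F θ k)) k)) (Window γ')) ∧
        (∀ b : ℝ, 0 < b → b ≤ γ' → L02 (Mb b)
          ((LevelPairing.ofRecordAdm F θ.τ9.M N k (fun (k j : ℕ) (_ : (domSys (F.P k) θ.τ9.M j).Dom) =>
            ofBackgroundC (ιSU N) '' {V : GaugeField (F.P k) 0 (Node00.SU N) | PlaqSmall (a F θ.toStage12Params k) V})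
          (gauge F θ k) (hg F θ k) (transportRaw F k (avOfRecord F N (k + 1) 0)) (admTransport_plaqSmall_sharp a ha hstep hguard F θ.toStage12Params k)).EB
            (runTowers (fun k => toClusterTower (G F θ k)) (k + 1)) b) (Window γ')) ∧
        (∀ b : ℝ, 0 < b → b ≤ γ' → L03 (Mb b)
          ((LevelPairing.ofRecordAdm F θ.τ9.M N k (fun (k j : ℕ) (_ : (domSys (F.P k) θ.τ9.M j).Dom) =>
            ofBackgroundC (ιSU N) '' {V : GaugeField (F.P k) 0 (Node00.SU N) | PlaqSmall (a F θ.toStage12Params k) V})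
          (gauge F θ k) (hg F θ k) (transportRaw F k (avOfRecord F N (k + 1) 0)) (admTransport_plaqSmall_sharp a ha hstep hguard F θ.toStage12Params k)).EB
            (runTowers (fun k => toClusterTower (G F θ k)) (k + 1)) b) (Window γ')) ∧
        (∀ b : ℝ, 0 < b → b ≤ γ' → L07 (Mb b) (Window γ') δ θr) ∧
        (∀ b : ℝ, 0 < b → b ≤ γ' → L08 (Mb b) (Window γ') κ (Real.exp 1 * 9 * 64 * K₀ 64 8 ^ 2 * A_B) δ' θr) ∧
        (∀ b : ℝ, 0 < b → b ≤ γ' → L09aff (Mb b) (Window γ')) ∧ (∀ b : ℝ, 0 < b → b ≤ γ' → L09blind (Mb b) (Window γ')) ∧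
        (∀ b : ℝ, 0 < b → b ≤ γ' → L09hom (Mb b) (Window γ')) ∧ (∀ b : ℝ, 0 < b → b ≤ γ' → L09unit (Mb b) (Window γ') κ E₁ cH ω) ∧
        0 < E₁ ∧ 0 ≤ δ + δ' ∧ 0 ≤ θr ∧ θr ≤ θ' ∧ θ' ≤ 1 ∧ 0 ≤ cH ∧ 0 < ω ∧ ρ₀ < 1 ∧
        (δ + δ') * θr ^ k₀ +
            cH * (Real.exp 1 * 9 * 64 * K₀ 64 8 ^ 2 * A_A + Real.exp 1 * 9 * 64 * K₀ 64 8 ^ 2 * A_B) / (1 - ω) ≤ ρ₀ ∧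
        0 ≤ B ∧ (∀ k < k₀, Real.exp 1 * 9 * 64 * K₀ 64 8 ^ 2 * A_A + Real.exp 1 * 9 * 64 * K₀ 64 8 ^ 2 * A_B ≤ B * θr ^ k) ∧
        Real.exp 1 * 9 * 64 * K₀ 64 8 ^ 2 * C3 * cH * ε₁ < (θ' - ω) * (1 - ρ₀) ∧
        (∀ m, SpRestr (fun _ : (domSys (F.P k) θ.τ9.M (m + 1)).Dom => ofBackgroundC (ιSU N) '' {V : GaugeField (F.P k) 0 (Node00.SU N) | PlaqSmall (a F θ.toStage12Params k) V})) ∧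
        (∀ m < k, ∀ t ∈ Dc F θ k, ∀ old : OlderTerms (F.P k) (MatA N) θ.τ9.M m,
          (∀ (j : Fin (m + 1)) (Y : (domSys (F.P k) θ.τ9.M j).Dom), ∀ ψ ∈ ofBackgroundC (ιSU N) '' {V : GaugeField (F.P k) 0 (Node00.SU N) | PlaqSmall (a F θ.toStage12Params k) V},
              ‖old j Y ψ‖ ≤ E_A * Real.exp (-(κ * (domSys (F.P k) θ.τ9.M j).dj Y))) →
          (∀ (j : Fin (m + 1)) (Y : (domSys (F.P k) θ.τ9.M j).Dom), AnalyticOnNhd ℂ (old j Y) (ofBackgroundC (ιSU N) '' {V : GaugeField (F.P k) 0 (Node00.SU N) | PlaqSmall (a F θ.toStage12Params k) V})) →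
          (∀ Z : (domSys (F.P k) θ.τ9.M (m + 1)).Dom, AnalyticOnNhd ℂ (fun φ => (G F θ k m).H t old φ Z) (ofBackgroundC (ιSU N) '' {V : GaugeField (F.P k) 0 (Node00.SU N) | PlaqSmall (a F θ.toStage12Params k) V})) ∧
          (∀ (Z : (domSys (F.P k) θ.τ9.M (m + 1)).Dom), ∀ φ ∈ ofBackgroundC (ιSU N) '' {V : GaugeField (F.P k) 0 (Node00.SU N) | PlaqSmall (a F θ.toStage12Params k) V},
              ‖(G F θ k m).H t old φ Z‖ ≤ A_A * Real.exp (-(Rd * (domSys (F.P k) θ.τ9.M (m + 1)).dj Z)))) ∧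
        0 ≤ A_A ∧ A_A * Real.exp (5 * κ + 1) * K₀ 64 8 * 9 * 64 < 1 ∧ Real.exp 1 * 9 * 64 * K₀ 64 8 ^ 2 * A_A ≤ E_A ∧
        (∀ m, SpRestr (fun _ : (domSys (F.P (k + 1)) θ.τ9.M (m + 1)).Dom => ofBackgroundC (ιSU N) '' {V : GaugeField (F.P (k + 1)) 0 (Node00.SU N) | PlaqSmall (a F θ.toStage12Params (k + 1)) V})) ∧
        (∀ m < k + 1, ∀ t ∈ Dc F θ k, ∀ old : OlderTerms (F.P (k + 1)) (MatA N) θ.τ9.M m,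
          (∀ (j : Fin (m + 1)) (Y : (domSys (F.P (k + 1)) θ.τ9.M j).Dom), ∀ ψ ∈ ofBackgroundC (ιSU N) '' {V : GaugeField (F.P (k + 1)) 0 (Node00.SU N) | PlaqSmall (a F θ.toStage12Params (k + 1)) V},
              ‖old j Y ψ‖ ≤ E_B * Real.exp (-(κ * (domSys (F.P (k + 1)) θ.τ9.M j).dj Y))) →
          (∀ (j : Fin (m + 1)) (Y : (domSys (F.P (k + 1)) θ.τ9.M j).Dom), AnalyticOnNhd ℂ (old j Y) (ofBackgroundC (ιSU N) '' {V : GaugeField (F.P (k + 1)) 0 (Node00.SU N) | PlaqSmall (a F θ.toStage12Params (k + 1)) V})) →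
          (∀ Z : (domSys (F.P (k + 1)) θ.τ9.M (m + 1)).Dom, AnalyticOnNhd ℂ (fun φ => (G F θ (k + 1) m).H t old φ Z) (ofBackgroundC (ιSU N) '' {V : GaugeField (F.P (k + 1)) 0 (Node00.SU N) | PlaqSmall (a F θ.toStage12Params (k + 1)) V})) ∧
          (∀ (Z : (domSys (F.P (k + 1)) θ.τ9.M (m + 1)).Dom), ∀ φ ∈ ofBackgroundC (ιSU N) '' {V : GaugeField (F.P (k + 1)) 0 (Node00.SU N) | PlaqSmall (a F θ.toStage12Params (k + 1)) V},
              ‖(G F θ (k + 1) m).H t old φ Z‖ ≤ A_B * Real.exp (-(Rd * (domSys (F.P (k + 1)) θ.τ9.M (m + 1)).dj Z)))) ∧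
        0 ≤ A_B ∧ A_B * Real.exp (5 * κ + 1) * K₀ 64 8 * 9 * 64 < 1 ∧ Real.exp 1 * 9 * 64 * K₀ 64 8 ^ 2 * A_B ≤ E_B ∧
        (∀ s ∈ Ioc (0 : ℝ) γ', ((s : ℝ) : ℂ) ∈ Dc F θ k) ∧
        θ.γ ≤ γ' ∧ (li F θ).κ ≤ κ ∧ θ' ≤ (li F θ).θ₅ ∧
        (Real.exp 1 * 9 * 64 * K₀ 64 8 ^ 2 * (C3 * ε₁) / (1 - ρ₀) * (δ + δ') + B) * (θ' - ω) /
            (θ' - (ω + Real.exp 1 * 9 * 64 * K₀ 64 8 ^ 2 * (C3 * ε₁) / (1 - ρ₀) * cH)) ≤ (li F θ).C₅)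
    -- N22 ⟸ N18 ON THE GENERATED TOWERS (dag-n22-e module 8b″): W1's per-step SCHEMAS for the generator `G F θ k` on the plaquette-small table + ONE inequality schema
    -- (the complex sup letter for the generated terms at the readings of the ε-small fields) + eleven numerals — verbatim; NO junk pin, NO coherence, NO readings clause
    (hsch : ∀ (F : T4Family) (θ : Stage13HParams F N), θ.Provisos₁₃CoPH F N → Rg F θ → θ.Admissible F N → ∀ (k : ℕ),
      ∃ (Dk : Set ℂ) (Adm : (m : ℕ) → Set (OlderTerms (F.P k) (MatA N) θ.τ9.M m)),
        IsOpen Dk ∧ (∀ z ∈ Dk, conj z ∈ Dk) ∧ (∀ t ∈ Ioc (0 : ℝ) θ.γ, closedBall (t : ℂ) (li F θ).r ⊆ Dk) ∧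
        (∀ g : ℕ → ℂ, (∀ n, g n ∈ Dk) → ∀ m < k, olderOf (recTerm (G F θ k) g) m ∈ Adm m) ∧
        (∀ m < k, (G F θ k m).AnalyticInLast Dk (Adm m) (fun _ : (domSys (F.P k) θ.τ9.M (m + 1)).Dom => ofBackgroundC (ιSU N) '' {V : GaugeField (F.P k) 0 (Node00.SU N) | PlaqSmall (a F θ.toStage12Params k) V})) ∧
        (∀ m < k, (G F θ k m).PropagatesAnalyticity Dk (Adm m) (fun (j : Fin (m + 1)) (_ : (domSys (F.P k) θ.τ9.M j).Dom) => ofBackgroundC (ιSU N) '' {V : GaugeField (F.P k) 0 (Node00.SU N) | PlaqSmall (a F θ.toStage12Params k) V}) (fun _ : (domSys (F.P k) θ.τ9.M (m + 1)).Dom => ofBackgroundC (ιSU N) '' {V : GaugeField (F.P k) 0 (Node00.SU N) | PlaqSmall (a F θ.toStage12Params k) V})) ∧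
        (∀ g ∈ Window θ.γ, ∀ (i j : ℕ), i < j → j ≤ k → ∀ (X : (domSys (F.P k) θ.τ9.M j).Dom), ∀ φ ∈ ofBackgroundC (ιSU N) '' {V : GaugeField (F.P k) 0 (Node00.SU N) | PlaqSmall (a F θ.toStage12Params k) V}, ∀ z ∈ Dk,
          ‖recTerm (G F θ k) (Function.update (fun n => ((g n : ℝ) : ℂ)) i z) j X φ‖ ≤
            (li F θ).A * (li F θ).μ ^ (j - 1 - i) * Real.exp (-((li F θ).κ * (domSys (F.P k) θ.τ9.M j).dj X))))
    (hnum : ∀ (F : T4Family) (θ : Stage13HParams F N), θ.Provisos₁₃CoPH F N → Rg F θ → θ.Admissible F N →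
      0 < (li F θ).C₀ ∧ 0 < (li F θ).θ₅ ∧ (li F θ).θ₅ < 1 ∧ 0 ≤ (li F θ).C₅ ∧ 2 * (li F θ).C₅ / (1 - (li F θ).θ₅) ≤ (li F θ).C₀ ∧ 0 < (li F θ).A ∧
        (li F θ).θ₅ ≤ (li F θ).μ ∧ (li F θ).C₀ ≤ 2 * (li F θ).A ∧ 0 < (li F θ).r ∧ 0 < (li F θ).s ∧ (li F θ).s < 1)
    (hD4 : ∀ (F : T4Family) (θ : Stage13HParams F N) (hP : θ.Provisos₁₃CoPH F N), Rg F θ → θ.Admissible F N → ∀ k : ℕ,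
      ReadOutAt (datumOfRecord₁₃CoPH F N θ hP) (u3OfRecord₁₃ θ.toStage13Params
        ((ReadingData.ofRecordAdm F θ.τ9.M N (runTowers fun k => toClusterTower (G F θ k))
          (fun (k j : ℕ) (_ : (domSys (F.P k) θ.τ9.M j).Dom) => ofBackgroundC (ιSU N) '' {V : GaugeField (F.P k) 0 (Node00.SU N) | PlaqSmall (a F θ.toStage12Params k) V})
          (gauge F θ) (hg F θ) (fun k => transportRaw F k (avOfRecord F N (k + 1) 0)) (admTransport_plaqSmall_sharp a ha hstep hguard F θ.toStage12Params) (li F θ)).u3Objects θ.γ) k))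
    (h20 : S_N20 (SRec₁₃CoPHOn cr Rg)) (h21 : S_N21 (SRec₁₃CoPHOn cr Rg))
    (hx : ∀ (F : T4Family) (θ : Stage13HParams F N) (hP : θ.Provisos₁₃CoPH F N), Rg F θ → θ.Admissible F N →
      B16.EndStatementBPrinted (datumOfRecord₁₃CoPH F N θ hP).C → DagBinding.EndpointExistence (datumOfRecord₁₃CoPH F N θ hP).C.toB12 →
        ForSmallCouplings (datumOfRecord₁₃CoPH F N θ hP) fun g₀ => ∀ os : List (ULoop F),
          0 < (cr F θ hP g₀ os).l₀ ∧ 0 < (cr F θ hP g₀ os).vol ∧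
          (∀ (K : ℕ) (t : ℝ), |t| ≤ (cr F θ hP g₀ os).l₀ →
            T4GenFunBounds.schemeZ ((datumOfRecord₁₃CoPH F N θ hP).scheme g₀) os ((cr F θ hP g₀ os).K₀ + K) t =
              ∑ τ ∈ (cr F θ hP g₀ os).T K, (cr F θ hP g₀ os).A K t τ) ∧
          (∀ (K : ℕ) (t : ℝ), |t| ≤ (cr F θ hP g₀ os).l₀ →
            T4GenFunBounds.schemeZ ((datumOfRecord₁₃CoPH F N θ hP).scheme g₀) os ((cr F θ hP g₀ os).K₀ + K + 1) t =
              ∑ τ ∈ (cr F θ hP g₀ os).T K, (cr F θ hP g₀ os).B K t τ))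
    (h19 : ∀ (F : T4Family) (θ : Stage13HParams F N) (hP : θ.Provisos₁₃CoPH F N), Rg F θ → θ.Admissible F N → ∀ (g₀ : ℕ → ℝ) (os : List (ULoop F)),
      (∀ k : ℕ, RatesAt (datumOfRecord₁₃CoPH F N θ hP) (rateCarriersOfRecord₁₃CoPH (readingOfRecord₁₃CoPH
        (fun F θ => ReadingData.ofRecordAdm F θ.τ9.M N (runTowers fun k => toClusterTower (G F θ k))
          (fun (k j : ℕ) (_ : (domSys (F.P k) θ.τ9.M j).Dom) => ofBackgroundC (ιSU N) '' {V : GaugeField (F.P k) 0 (Node00.SU N) | PlaqSmall (a F θ.toStage12Params k) V})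
          (gauge F θ) (hg F θ) (fun k => transportRaw F k (avOfRecord F N (k + 1) 0)) (admTransport_plaqSmall_sharp a ha hstep hguard F θ.toStage12Params) (li F θ)) ℓ₃ ne2 ne1)
          F θ hP g₀ os k)) →
        letI := (cr F θ hP g₀ os).dec
        ∃ δ : ℕ → ℝ, NE7.Core (cr F θ hP g₀ os).l₀ (cr F θ hP g₀ os).vol (cr F θ hP g₀ os).T (cr F θ hP g₀ os).Bad
          (fun K t τ => (cr F θ hP g₀ os).A K t τ - (cr F θ hP g₀ os).shA K t τ) (fun K t τ => (cr F θ hP g₀ os).B K t τ - (cr F θ hP g₀ os).shB K t τ) δ ∧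
          Summable δ) :
    Spine (N := N) fun F D w => Node00.IsRecordOfRecord₁₃CCoPHOn F N Rg D w :=
  have h18' := s_N18_rRec₁₃CoPHOn_readingAdm_runTowers_toClusterTower_of_stepGen_lt_pin _ Rg G Dc
    (fun F θ (k j : ℕ) (_ : (domSys (F.P k) θ.τ9.M j).Dom) => ofBackgroundC (ιSU N) '' {V : GaugeField (F.P k) 0 (Node00.SU N) | PlaqSmall (a F θ.toStage12Params k) V})
    gauge hg (fun F _ k => transportRaw F k (avOfRecord F N (k + 1) 0)) (fun F θ => admTransport_plaqSmall_sharp a ha hstep hguard F θ.toStage12Params) li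
    (readingOfRecord₁₃CoPH_u3 _ ℓ₃ ne2 ne1) h18
  spine_rec13CCoPHOn_at_readingOfRecord₁₃CoPH cr _ ℓ₃ ne2 ne1 Rg
    ((s_N14_rRec₁₃CoPHOn_iff _ Rg).mpr fun F θ hP hRg hθ g₀ os => h14 F θ hP hRg hθ g₀ os)
    ((s_N15_rRec₁₃CoPHOn_iff _ Rg).mpr fun F θ hP hRg hθ g₀ os k => h15 F θ hP hRg hθ g₀ os k)
    (s_N16_rRec₁₃CoPHOn_ofRecord_of_leafSlot (readingOfRecord₁₃CoPH _ ℓ₃ ne2 ne1) Rg ℓ₃ (fun _ _ _ _ _ _ => rfl) h16) h18'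
    (s_N22_readingOfRecord₁₃CoPHOn_gen_of_s_N18_schemasBelow G
      (fun F θ (k j : ℕ) (_ : (domSys (F.P k) θ.τ9.M j).Dom) => ofBackgroundC (ιSU N) '' {V : GaugeField (F.P k) 0 (Node00.SU N) | PlaqSmall (a F θ.toStage12Params k) V})
      gauge hg (fun F _ k => transportRaw F k (avOfRecord F N (k + 1) 0))
      (fun F θ => admTransport_plaqSmall_sharp a ha hstep hguard F θ.toStage12Params) li ne1 ℓ₃ ne2 Rg h18' hsch hnum)
    ((s_D4_rRec₁₃CoPHOn_iff _ Rg).mpr fun F θ hP hRg hθ _ _ k => hD4 F θ hP hRg hθ k) h20 h21 hx h19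

end Regime

end Summit.QuantumFields.YangMills.Theorems.BalabanUVNodesN27SpineRecord

end
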